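import Summits.QuantumFields.YangMills.Theorems.LuscherReductionTwistedTraceScalingBOStiffCoreMass
import Summits.QuantumFields.YangMills.Theorems.FlatTubeReductionStiffKCoreCoeff
import Summits.QuantumFields.YangMills.Theorems.FlatTubeReductionStiffKWeightTransport
import HarnessLib


/-!
# (B-ST) K-port, part 5: the STIFF CURRENCY, the currency in `c`-form and the positivity of the central mass, at a GENERAL CAP CONSTANT `K ≥ 1`
# (route `FlatTubeReduction`, crux K1 `NearFlatRatioLaw` stmt-QuantumFields-24720, line `ratepack_v2`, stub `stub_hST_A`; seat `ym-line-ftr-p1` g20; R2b1 RECORD rung — no summit statement is proved here)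

Lane A's ✓`…BOStiffCurrency.stiff_currency_record`, ✓`…BOStiffCoreData.eventually_kappa_cLambda_le` and ✓`…BOStiffCoreMass.central_mass_pos` VERBATIM with the cap constant `43`
of `recordChi L s 43 M β` replaced by a parameter `K ≥ 1` (the rate twin's stub `stub_hST_A` needs `K = 42·max 1 (|Site 3 L|/7) + 1` at `s = 1/6`), in the K-vocabulary
`cWK`/`cΛK` of ✓`…FlatTubeReductionStiffKDefs`:
* ★★ `stiff_currency_record_K` — `Λ_c·(∫ cΘ·(∫ cM cΘ))/Z̄ ≤ (1+a)·Λ_rec` eventually;  ★★ `eventually_kappa_cLambdaK_le` — the same in `c`-form;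
* `central_mass_pos_K` — `0 < ∫_{cS} cΘ²cWK`, `0 < ∫ cΘ²cWK`, `0 < cΛK` from the door data.
HONEST FRAMING: text port (slot substitution `43 ↦ K`) of lane A's bookkeeping for a stub of the crux K1 of the CONDITIONAL route R2b1 (RECORD rung); no new mathematics; not infinite volume,
not a gap, not Clay.
-/

set_option autoImplicit false

noncomputable section

open MeasureTheory Filter Topology Real
open scoped BigOperators
open Literature.MathematicalPhysics.QuantumFieldTheory
open Literature.MathematicalPhysics.QuantumLattice

namespace Summit.QuantumFields.YangMills.Theorems.FemtoTransferGap.TwoLattice.ConstTube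

open Summit.QuantumFields.YangMills.Theorems.FemtoTransferGap
open Summit.QuantumFields.YangMills.Theorems.FemtoTransferGap.TwoLattice
open Summit.QuantumFields.YangMills.Theorems.FemtoTransferGap.TwoLattice.Avg
open Summit.QuantumFields.YangMills.Theorems.FemtoTransferGap.TwoLattice.Stiff
open Summit.QuantumFields.YangMills.Theorems.FemtoTransferGap.TwoLattice.GnChart
open Summit.QuantumFields.YangMills.Theorems.FemtoTransferGap.TwoLattice.Cov
open Summit.QuantumFields.YangMills.Theorems.FemtoTransferGap.TwoLattice.Toron
open Summit.QuantumFields.YangMills.Theorems.TwistedTraceScaling.Negative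

variable {L : ℕ} [NeZero L]

/-! ## §1 ★★ The stiff currency at cap constant `K` -/

set_option maxHeartbeats 1600000 in
-- long record expressions.
/-- ★★★ **THE (B-ST) CURRENCY OF RECORD** (see the module docstring). [cite: Luscher1983, §3] [cite: SeilerLNP1982, §3] -/
theorem stiff_currency_record_K {K : ℝ} (hK : 1 ≤ K) (hLz : Nonempty (NzSite L)) {s : ℝ} (hs : 0 < s) (hs3 : s ≤ 1 / 3) :
    ∃ M₀ : ℝ, 2 ≤ M₀ ∧ ∀ M : ℝ, M₀ ≤ M → ∀ a : ℝ, 0 < a → ∀ᶠ β : ℝ in atTop,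
      levelValue su2Rep 1 ((L : ℝ) ^ 3 * β) 0 / transferKernel su2Rep ((L : ℝ) ^ 3 * β) (1 : GaugeConfig 3 1 SU2) 1 *
          ((∫ v, ({x : LinkSpace L | linkCurry x ∈ capBalancedSet L}.indicator (fun _ => (1 : ℝ)) (linkEmbed L v) *
                  frozenProfile L (fun β' => stiffGaussExp L (β' / 2) β') (fun β' => min (1 / 40) (powScale (1 / 2) β' * btLog β')) β (linkEmbed L v)) *
                (∫ v', (∫ h, transferKernel su2Rep β (orthoTube L 1 v) (gaugeTransform (basedExt L h) (orthoTube L 1 v')) ∂basedMeasure L) *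
                  ({x : LinkSpace L | linkCurry x ∈ capBalancedSet L}.indicator (fun _ => (1 : ℝ)) (linkEmbed L v') *
                    frozenProfile L (fun β' => stiffGaussExp L (β' / 2) β') (fun β' => min (1 / 40) (powScale (1 / 2) β' * btLog β')) β (linkEmbed L v')) ∂orthoTransverse L)
              ∂orthoTransverse L) /
            fibreMass L (softWeight (recordChi L s K M β)) (fun x : LinkSpace L => {x : LinkSpace L | linkCurry x ∈ capBalancedSet L}.indicator (fun _ => (1 : ℝ)) x *
              frozenProfile L (fun β' => stiffGaussExp L (β' / 2) β') (fun β' => min (1 / 40) (powScale (1 / 2) β' * btLog β')) β x) 1) ≤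
        (1 + a) * (btC L β (fun x : LinkSpace L => {x : LinkSpace L | linkCurry x ∈ capBalancedSet L}.indicator (fun _ => (1 : ℝ)) x * frozenProfile L (fun β' => stiffGaussExp L (β' / 2) β') (fun β' => min (1 / 40) (powScale (1 / 2) β' * btLog β')) β x) (btEps β) (5 * (powScale (1 / 2) β * btLog β ^ 2)) / fpZ (btEps β) / recordGamma L (fun β' => fun x : LinkSpace L => {x : LinkSpace L | linkCurry x ∈ capBalancedSet L}.indicator (fun _ => (1 : ℝ)) x * frozenProfile L (fun β'' => stiffGaussExp L (β'' / 2) β'') (fun β'' => min (1 / 40) (powScale (1 / 2) β'' * btLog β'')) β' x) β *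
          levelValue su2Rep 1 ((L : ℝ) ^ 3 * β) 0) := by
  -- (P) for the fibre-mass brick at `u = 1`
  have hK0 : 0 < K := lt_of_lt_of_le one_pos hK
  have hδ0 : ∀ β, 0 < K * powScale s β := fun β => mul_pos hK0 (powScale_pos s β)
  have hδ : Tendsto (fun β => K * powScale s β) atTop (𝓝 0) := by simpa using (tendsto_powScale hs).const_mul K
  have hsd1 : ∀ᶠ β in atTop, 0 < powScale 1 β ∧ powScale 1 β ≤ (K * powScale s β) ^ 3 := by
    filter_upwards [eventually_ge_atTop (1 : ℝ)] with β hβ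
    have hp := powScale_pos 1 β
    have h1 : powScale 1 β ≤ powScale s β ^ 3 := powScale_one_le_cube hs3 hβ
    have hps0 : 0 ≤ powScale s β ^ 3 := pow_nonneg (powScale_pos s β).le 3
    refine ⟨hp, h1.trans ?_⟩
    calc powScale s β ^ 3 = 1 * powScale s β ^ 3 := (one_mul _).symm
      _ ≤ K ^ 3 * powScale s β ^ 3 := mul_le_mul_of_nonneg_right (one_le_pow₀ hK) hps0
      _ = (K * powScale s β) ^ 3 := by ring
  obtain ⟨M₀, hM₀, H⟩ := fpWeight_core_constant L hLz hδ0 hδ hsd1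
  refine ⟨M₀, hM₀, fun M hM a ha => ?_⟩
  obtain ⟨C, β₀, hC, hP⟩ := H M hM
  have hM2 : 2 ≤ M := hM₀.trans hM
  have hδ2 : Tendsto (fun β => (K * powScale s β) ^ 2) atTop (𝓝 0) := by simpa using hδ.pow 2
  have ha3 : 0 < a / 3 := by positivity
  have hκa : (0 : ℝ) < a / (3 * (1 + a)) := by positivity
  obtain ⟨cΛK, KΛ, hcΛ, hΛev⟩ := recordLambda_floor (L := L)
  filter_upwards [eventually_ge_atTop β₀, eventually_mul_le_of_tendsto hδ2 C (by norm_num : (0 : ℝ) < 1 / 2), eventually_mul_le_of_tendsto hδ2 C hκa,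
    eventually_boRayleigh_le_recordCurrency (L := L) ha3, eventually_orthoTube_one_mem_fatTube_K (L := L) hK hs (by linarith) hM2, eventually_ge_atTop (0 : ℝ), hΛev]
    with β hβ0 hκ1 hκ2 hcur hgeo hβ hΛfloor
  -- names
  set Ω : LinkSpace L → ℝ := fun x => {x : LinkSpace L | linkCurry x ∈ capBalancedSet L}.indicator (fun _ => (1 : ℝ)) x *
    frozenProfile L (fun β' => stiffGaussExp L (β' / 2) β') (fun β' => min (1 / 40) (powScale (1 / 2) β' * btLog β')) β x with hΩdef
  set κ₀ : ℝ := levelValue su2Rep 1 ((L : ℝ) ^ 3 * β) 0 / transferKernel su2Rep ((L : ℝ) ^ 3 * β) (1 : GaugeConfig 3 1 SU2) 1 with hκ₀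
  set γ : ℝ := recordGamma L (fun β' => fun x : LinkSpace L => {x : LinkSpace L | linkCurry x ∈ capBalancedSet L}.indicator (fun _ => (1 : ℝ)) x *
      frozenProfile L (fun β'' => stiffGaussExp L (β'' / 2) β'') (fun β'' => min (1 / 40) (powScale (1 / 2) β'' * btLog β'')) β' x) β with hγ
  set Λ : ℝ := btC L β Ω (btEps β) (5 * (powScale (1 / 2) β * btLog β ^ 2)) / fpZ (btEps β) / γ * levelValue su2Rep 1 ((L : ℝ) ^ 3 * β) 0 with hΛ
  set Z : ℝ := fibreMass L (softWeight (recordChi L s K M β)) Ω 1 with hZ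
  set κ : ℝ := C * (K * powScale s β) ^ 2 with hκdef
  have hκ0 : 0 ≤ κ := by positivity
  -- structural fields of the profile
  have hqf0 : ∀ β' x, 0 ≤ (fun β'' : ℝ => stiffGaussExp L (β'' / 2) β'') β' x := fun β' x => stiffGaussExp_nonneg _ _ x
  have hqinv : ∀ β' (g : SU2) (x : LinkSpace L), (fun β'' : ℝ => stiffGaussExp L (β'' / 2) β'') β' (adL L g x) = (fun β'' : ℝ => stiffGaussExp L (β'' / 2) β'') β' x :=
    fun β' g x => stiffGaussExp_adL _ _ g x
  have hΩGm : Measurable (frozenProfile L (fun β' => stiffGaussExp L (β' / 2) β') (fun β' => min (1 / 40) (powScale (1 / 2) β' * btLog β')) β) :=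
    measurable_frozenProfile (fun β' => measurable_stiffGaussExp _ _) _ β
  have hΩG0 : ∀ x, 0 ≤ frozenProfile L (fun β' => stiffGaussExp L (β' / 2) β') (fun β' => min (1 / 40) (powScale (1 / 2) β' * btLog β')) β x :=
    fun x => (frozenProfile_mem_Icc hqf0 _ β x).1
  have hΩG1 : ∀ x, |frozenProfile L (fun β' => stiffGaussExp L (β' / 2) β') (fun β' => min (1 / 40) (powScale (1 / 2) β' * btLog β')) β x| ≤ 1 :=
    abs_frozenProfile_le hqf0 _ β
  have hΩm : Measurable Ω := measurable_capRestrict (L := L) hΩGm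
  have hΩ1 : ∀ x, |Ω x| ≤ 1 := fun x => (capRestrict_mem (L := L) hΩG0 hΩG1 x).2.2
  have hΩinv : ∀ (g : SU2) (x : LinkSpace L), Ω (adL L g x) = Ω x := fun g x => capRestrict_adL (L := L) (fun g' x' => frozenProfile_adL hqinv _ β g' x') g x
  have hΩR : ∀ x, Ω x ≠ 0 → ‖x‖ ≤ min (1 / 40) (powScale (1 / 2) β * btLog β) := fun x hx => norm_le_of_frozenProfile_ne_zero _ _ β (right_ne_zero_of_mul hx)
  -- (i) the matching identity
  have hid := boKernel_one_one_eq_based (L := L) β hΩm hΩ1 hΩinv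
  rw [← hid]
  -- (iii) `Z ≥ (1−κ)γ`
  have hP' : ∀ U ∈ fatTubeRho L (fun β : ℝ => K * powScale s β) (fun b => M * (K * powScale s b)) β,
      fpWeightBar L (powScale 1 β) * (1 - κ) ≤ gaugeAvg (recordWeightRho L (fun β : ℝ => K * powScale s β) (fun b => M * (K * powScale s b)) (powScale 1) β) U ∧
      gaugeAvg (recordWeightRho L (fun β : ℝ => K * powScale s β) (fun b => M * (K * powScale s b)) (powScale 1) β) U ≤ fpWeightBar L (powScale 1 β) * (1 + κ) :=
    fun U hU => hP β hβ0 U hU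
  have hb := fibreMass_brick_record (L := L) (fun β : ℝ => K * powScale s β) (fun b => M * (K * powScale s b)) (powScale 1) β hP' hΩm hΩ1 hΩR
    (u := 1) (fun x _ hx => hgeo x hx)
  have hbZ : |Z - γ| ≤ κ * γ := hb
  have hγ0 : 0 < γ := by rw [hγ]; exact recordGamma_record_pos (L := L) hβ
  have hZlo : (1 - κ) * γ ≤ Z := by have h1 := (abs_le.mp hbZ).1; linarith
  have hZ0 : 0 < Z := lt_of_lt_of_le (by nlinarith) hZlo
  -- (ii) the cut: `κ₀·𝒦/γ ≤ (1 + a/3)Λ`; also `𝒦 ≥ 0`, `Λ ≥ 0`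
  have hcur' : κ₀ * (boKernel L β Ω 1 1 / γ) ≤ (1 + a / 3) * Λ := hcur
  have hK0 : 0 < transferKernel su2Rep ((L : ℝ) ^ 3 * β) (1 : GaugeConfig 3 1 SU2) 1 := transferKernel_pos _ _ _ _
  have hκ₀0 : 0 ≤ κ₀ := div_nonneg (levelValue_zero_su2Rep_pos 1 ((L : ℝ) ^ 3 * β)).le hK0.le
  have hbo0 : 0 ≤ boKernel L β Ω 1 1 := by
    -- `fpZ·𝒦 = btC·K₁ + cut ≥ 0`
    have hsplit := R65.btC_mul_oneSite_add_tail (L := L) β (btEps β) (5 * (powScale (1 / 2) β * btLog β ^ 2)) hΩm hΩ1 hΩinv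
    have hZp : 0 < fpZ (btEps β) := fpZ_pos (by unfold btEps; exact powScale_pos 1 β)
    have hcut0 : 0 ≤ fpBOKernel L β Ω (tailWeight L (btEps β) (5 * (powScale (1 / 2) β * btLog β ^ 2))) 1 1 :=
      fpBOKernel_nonneg β hΩm hΩ1 (fun x => (capRestrict_mem (L := L) hΩG0 hΩG1 x).1) (measurable_tailWeight _ _) (abs_tailWeight_le _ _) (fun g => (tailWeight_mem_Icc _ _ g).1) 1 1
    have hC0 : 0 ≤ btC L β Ω (btEps β) (5 * (powScale (1 / 2) β * btLog β ^ 2)) := by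
      unfold btC
      exact div_nonneg (fpBOKernel_nonneg β hΩm hΩ1 (fun x => (capRestrict_mem (L := L) hΩG0 hΩG1 x).1) (measurable_coreWeight _ _) (abs_coreWeight_le _ _)
        (fun g => (coreWeight_mem_Icc _ _ g).1) 1 1) hK0.le
    have : 0 ≤ fpZ (btEps β) * boKernel L β Ω 1 1 := by rw [← hsplit]; positivity
    exact (mul_nonneg_iff_of_pos_left hZp).mp this
  have hΛ0 : 0 ≤ Λ := le_trans (mul_pos (mul_pos hcΛ (pow_pos (powScale_pos 1 β) _)) (pow_pos (Real.exp_pos _) _)).le hΛfloor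
  -- assemble: `κ₀·𝒦/Z ≤ κ₀·𝒦/((1−κ)γ) ≤ (1+a/3)/(1−κ)·Λ ≤ (1+a)Λ`
  have h1 : κ₀ * (boKernel L β Ω 1 1 / Z) ≤ κ₀ * (boKernel L β Ω 1 1 / ((1 - κ) * γ)) := by
    refine mul_le_mul_of_nonneg_left (div_le_div_of_nonneg_left hbo0 (by nlinarith) hZlo) hκ₀0
  have h2 : κ₀ * (boKernel L β Ω 1 1 / ((1 - κ) * γ)) = (κ₀ * (boKernel L β Ω 1 1 / γ)) / (1 - κ) := by
    field_simp
  have h3 : (κ₀ * (boKernel L β Ω 1 1 / γ)) / (1 - κ) ≤ (1 + a / 3) * Λ / (1 - κ) := div_le_div_of_nonneg_right hcur' (by linarith)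
  have h4 : (1 + a / 3) * Λ / (1 - κ) ≤ (1 + a) * Λ := by
    rw [div_le_iff₀ (by linarith)]
    -- `(1 + a/3) ≤ (1 + a)(1 − κ)` since `κ(1+a) ≤ a/3·2`... precisely `κ ≤ a/(3(1+a))`
    have hk : κ * (1 + a) ≤ a / 3 := by
      have := hκ2; rw [hκdef] at this ⊢
      have h := (le_div_iff₀ (by positivity : (0 : ℝ) < 3 * (1 + a))).mp this
      nlinarith
    nlinarith
  calc κ₀ * (boKernel L β Ω 1 1 / Z) ≤ κ₀ * (boKernel L β Ω 1 1 / ((1 - κ) * γ)) := h1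
    _ = (κ₀ * (boKernel L β Ω 1 1 / γ)) / (1 - κ) := h2
    _ ≤ (1 + a / 3) * Λ / (1 - κ) := h3
    _ ≤ (1 + a) * Λ := h4

set_option maxHeartbeats 800000 in
-- record-size expressions.
/-- ★★ **CURRENCY**: `∃ M₀ ≥ 2, ∀ M ≥ M₀, ∀ a > 0, ∀ᶠ β`, `(topValue su2Rep 1 (L³β)/K₁(1,1))·cΛK L s K M β ≤ (1+a)·Λ_rec(β)`. [cite: Luscher1983, §3] -/
theorem eventually_kappa_cLambdaK_le {K : ℝ} (hK : 1 ≤ K) (hLz : Nonempty (NzSite L)) {s : ℝ} (hs : 0 < s) (hs3 : s ≤ 1 / 3) :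
    ∃ M₀ : ℝ, 2 ≤ M₀ ∧ ∀ M : ℝ, M₀ ≤ M → ∀ a : ℝ, 0 < a → ∀ᶠ β : ℝ in atTop,
      topValue su2Rep 1 ((L : ℝ) ^ 3 * β) / transferKernel su2Rep ((L : ℝ) ^ 3 * β) (1 : GaugeConfig 3 1 SU2) 1 * cΛK L s K M β ≤
        (1 + a) * (btC L β (fun x : LinkSpace L => {x : LinkSpace L | linkCurry x ∈ capBalancedSet L}.indicator (fun _ => (1 : ℝ)) x * frozenProfile L (fun β' => stiffGaussExp L (β' / 2) β') (fun β' => min (1 / 40) (powScale (1 / 2) β' * btLog β')) β x) (btEps β) (5 * (powScale (1 / 2) β * btLog β ^ 2)) / fpZ (btEps β) / recordGamma L (fun β' => fun x : LinkSpace L => {x : LinkSpace L | linkCurry x ∈ capBalancedSet L}.indicator (fun _ => (1 : ℝ)) x * frozenProfile L (fun β'' => stiffGaussExp L (β'' / 2) β'') (fun β'' => min (1 / 40) (powScale (1 / 2) β'' * btLog β'')) β' x) β *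
          levelValue su2Rep 1 ((L : ℝ) ^ 3 * β) 0) := by
  obtain ⟨M₀, hM₀, H⟩ := stiff_currency_record_K (L := L) hK hLz hs hs3
  refine ⟨M₀, hM₀, fun M hM a ha => ?_⟩
  filter_upwards [H M hM a ha] with β hβ
  have e1 : topValue su2Rep 1 ((L : ℝ) ^ 3 * β) = levelValue su2Rep 1 ((L : ℝ) ^ 3 * β) 0 := (levelValue_zero su2Rep 1 _).symm
  have e2 : cΛK L s K M β = (∫ x, cΘ L β x * ∫ y, cM L β x y * cΘ L β y ∂orthoTransverse L ∂orthoTransverse L) /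
      fibreMass L (softWeight (recordChi L s K M β)) (cΩ L β) 1 := by
    unfold cΛK; rw [cLambda_num_eq, fibreMass_eq_cMass_K]
  rw [e1, e2]
  exact hβ

/-- From the door data at `β` (`∫_{cS} D > 0`, `D ≤ C'ν·cΘ²cW` on `cS`, a floor `θ₀ ≤ cΘ` on `cS`) and the upper quasimode on `cS`:
`0 < ∫_{cS} cΘ²cW`, `0 < ∫ cΘ²cW`, `0 < cΛK`. [folklore] -/
theorem central_mass_pos_K {s K M β : ℝ} (hβ : 0 ≤ β) {D : (Edge 3 L → Fin 3 → ℝ) → ℝ} {CD C'ν θ₀ η : ℝ} (hD : Measurable D) (hDb : ∀ x, |D x| ≤ CD) (hC'ν : 0 < C'ν)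
    (hθ₀ : 0 < θ₀) (hΘlo : ∀ x ∈ cS L β, θ₀ ≤ cΘ L β x) (hZD : 0 < ∫ x in cS L β, D x ∂orthoTransverse L)
    (hν' : ∀ x ∈ cS L β, D x ≤ C'ν * (cΘ L β x ^ 2 * cWK L s K M β x)) (hη : 0 ≤ η)
    (hup : ∀ x ∈ cS L β, ∫ y, cM L β x y * cΘ L β y ∂orthoTransverse L ≤ (1 + η) * cΛK L s K M β * (cΘ L β x * cWK L s K M β x)) :
    0 < ∫ x in cS L β, cΘ L β x ^ 2 * cWK L s K M β x ∂orthoTransverse L ∧ 0 < ∫ x, cΘ L β x ^ 2 * cWK L s K M β x ∂orthoTransverse L ∧ 0 < cΛK L s K M β := by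
  haveI := isFiniteMeasure_orthoTransverse L
  obtain ⟨hMm, ⟨CM, hMb⟩, -, -, hΘm, hΘ1, hΘ0, hΘS, hSm⟩ := central_kform_data (L := L) hβ
  obtain ⟨hwm, hwb, hw0⟩ := cWK_props (L := L) s K M β
  have hΘle1 : ∀ x, cΘ L β x ≤ 1 := fun x => (le_abs_self _).trans (hΘ1 x)
  have hfm : Measurable fun x => cΘ L β x ^ 2 * cWK L s K M β x := (hΘm.pow_const 2).mul hwm
  have hfi : Integrable (fun x => cΘ L β x ^ 2 * cWK L s K M β x) (orthoTransverse L) :=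
    integrable_of_measurable_abs_le _ hfm (C := 1 * Real.exp ((Fintype.card (Edge 3 L) : ℝ) / powScale 1 β ^ 2)) fun x => by
      rw [abs_mul, abs_pow]
      exact mul_le_mul (by rw [← one_pow 2]; exact pow_le_pow_left₀ (abs_nonneg _) (hΘ1 x) 2) (hwb x) (abs_nonneg _) zero_le_one
  have hf0 : ∀ x, 0 ≤ cΘ L β x ^ 2 * cWK L s K M β x := fun x => mul_nonneg (sq_nonneg _) (hw0 x)
  have hDi : Integrable D (orthoTransverse L) := integrable_of_measurable_abs_le _ hD hDb
  -- `∫_S D ≤ C'ν ∫_S Θ²w`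
  have h1 : ∫ x in cS L β, D x ∂orthoTransverse L ≤ C'ν * ∫ x in cS L β, cΘ L β x ^ 2 * cWK L s K M β x ∂orthoTransverse L := by
    rw [← integral_const_mul]
    exact setIntegral_mono_on hDi.integrableOn (hfi.const_mul _).integrableOn hSm fun x hx => hν' x hx
  have hZS : 0 < ∫ x in cS L β, cΘ L β x ^ 2 * cWK L s K M β x ∂orthoTransverse L := by
    by_contra hle
    push Not at hle
    have : C'ν * ∫ x in cS L β, cΘ L β x ^ 2 * cWK L s K M β x ∂orthoTransverse L ≤ 0 := mul_nonpos_of_nonneg_of_nonpos hC'ν.le hle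
    linarith
  have hZ : 0 < ∫ x, cΘ L β x ^ 2 * cWK L s K M β x ∂orthoTransverse L :=
    lt_of_lt_of_le hZS (setIntegral_le_integral hfi (ae_of_all _ hf0))
  refine ⟨hZS, hZ, ?_⟩
  -- a point of `cS` (it has positive measure)
  have hSpos : 0 < orthoTransverse L (cS L β) := by
    by_contra hle
    push Not at hle
    have h0 : orthoTransverse L (cS L β) = 0 := nonpos_iff_eq_zero.mp hle
    have : ∫ x in cS L β, cΘ L β x ^ 2 * cWK L s K M β x ∂orthoTransverse L = 0 := by rw [Measure.restrict_eq_zero.mpr h0, integral_zero_measure]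
    linarith
  obtain ⟨x₀, hx₀⟩ := nonempty_of_measure_ne_zero hSpos.ne'
  -- `0 < ∫ cM(x₀,·) cΘ`
  have hgm : Measurable fun y => cM L β x₀ y * cΘ L β y := (hMm.comp (measurable_const.prodMk measurable_id)).mul hΘm
  have hgi : Integrable (fun y => cM L β x₀ y * cΘ L β y) (orthoTransverse L) :=
    integrable_of_measurable_abs_le _ hgm (C := CM * 1) fun y => by rw [abs_mul]; exact mul_le_mul (hMb _ _) (hΘ1 y) (abs_nonneg _) ((abs_nonneg _).trans (hMb x₀ y))
  have hg0 : ∀ y, 0 ≤ cM L β x₀ y * cΘ L β y := fun y => mul_nonneg (cM_pos β x₀ y).le (hΘ0 y)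
  have hIpos : 0 < ∫ y, cM L β x₀ y * cΘ L β y ∂orthoTransverse L := by
    rw [integral_pos_iff_support_of_nonneg hg0 hgi]
    refine lt_of_lt_of_le hSpos (measure_mono fun y hy => ?_)
    exact (mul_pos (cM_pos β x₀ y) (lt_of_lt_of_le hθ₀ (hΘlo y hy))).ne'
  have hu := hup x₀ hx₀
  by_contra hΛ
  push Not at hΛ
  have : (1 + η) * cΛK L s K M β * (cΘ L β x₀ * cWK L s K M β x₀) ≤ 0 :=
    mul_nonpos_of_nonpos_of_nonneg (mul_nonpos_of_nonneg_of_nonpos (by linarith) hΛ) (mul_nonneg (hΘ0 x₀) (hw0 x₀))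
  linarith

end Summit.QuantumFields.YangMills.Theorems.FemtoTransferGap.TwoLattice.ConstTube

end
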